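import Summits.AnomalousDissipation.AnomalousDissipation.Theorems.BaireTransferDenseLoudDesignerForcesErgodicConjugatedMildIdentity
import Literature.Analysis.FluidPDE.TorusClassicalNSTimeDerivLinearised
import Literature.Analysis.FunctionSpaces.TorusSpaceTimeTaylor

/-!
# The frame curve of a classical trajectory is differentiable, with derivative the frame of `∂ₜu`
# (line `ergodic-budget-selection-closing`, crux `BaireTransfer.DenseLoudDesignerForces`,
# stmt-AnomalousDissipation-1143) — tools stub A3a of block N-A

Sorry-free file over the landed vocabulary `…ErgodicLine.lean` (`Hsp = Torus.energySpace (Fin 3)`, `rep`),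
`…ErgodicPeriodicOrbitA.lean` (`stateOf`, `rep_stateOf`, `stub_trajectoryPowerBudget_aux_norm_sq`), the frame plumbing
of S5b `…ErgodicConjugatedMildIdentity.lean` (`eq_frame_apply_of_frame_apply_eq_stateOf`: `S z = [v]` forces
`z = S ([v] − [Δv])`), the time-derivative calculus of classical solutions
(`Torus.IsClassicalNSSolutionOn.isDivFree_timeDerivWithin`, `Torus.IsSmoothSpaceTimeOn.hasZeroMean_timeDerivWithin`,
`Torus.timeDerivWithin_laplacian_comm`) and the uniform first-order Taylor expansion in time of jointly smooth fields
(`Torus.IsSmoothSpaceTimeOn.eventually_integral_norm_sub_sub_smul_sq_le`, `….isDivFree_timeDerivWithin`,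
`Literature/Analysis/FunctionSpaces/TorusSpaceTimeTaylor.lean`).

Block N-A of the line reads the flow direction of the smooth model at a core point, `d/dt|₀₊` of the frame curve
`y` (`S (y t) = [u(a₀ + t)]`, `S = diag((1 + m)^{-1/2})` on the Stokes mode basis), as the frame of `∂ₜu`, which
solves the linearised equation (A1).  This file proves the differentiability behind it:

* `norm_stateOf_sub_sub_smul_sq` — `‖[v] − [w] − c • [z]‖² = ∫‖v − w − c • z‖²` for honest fields;
* `hasDerivWithinAt_stateOf` — **the state curve of a jointly smooth honest field is differentiable in `H`**: for `v`
  jointly smooth on `[a, b] × T³` with divergence-free mean-zero slices, `s ↦ [v s]` has derivative `[∂ₜv t]` within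
  `[a, b]` at every `t` (`∂ₜv t` is smooth, divergence free and mean zero, and
  `‖[v s] − [v t] − (s − t) • [∂ₜv t]‖² = ∫‖v s − v t − (s − t) • ∂ₜv t‖² ≤ (ε |s − t|)²` for `s` near `t`);
* `stub_frameCurveDerivTools` (the REGISTERED tools stub A3a) — if `S (y t) = [u(a₀ + t)]` and
  `S (y₁ t) = [∂ₜu(a₀ + t)]` on `[0, τ']` for a classical solution `u` with mean-zero slices, then
  `HasDerivWithinAt y (y₁ t) (Icc 0 τ') t`: on the window `y = S ([u] − [Δu])(a₀ + ·)` and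
  `y₁ t = S ([∂ₜu] − [Δ∂ₜu])(a₀ + t)` (frame preimages), the state curves of `u` and of the jointly smooth honest
  field `Δu` are differentiable with derivatives `[∂ₜu]`, `[∂ₜΔu] = [Δ∂ₜu]`, and `S` is a bounded operator.

References: P. Constantin, C. Foias, *Navier–Stokes Equations* (Chicago 1988), Ch. 5 (5.9)–(5.10) (strong solutions
as `H`-valued `C¹` curves), Ch. 4 (4.11)–(4.13) (`(1 + A)^{-1/2}`); R. Temam, *Navier–Stokes Equations and Nonlinear
Functional Analysis* (2nd ed. 1995), §3.4 (the equation for `u' = du/dt`).  Nothing is asserted; no definition is added.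
-/

-- `Summit.<Summit>.<Problem>` is the tree's mandated summit-side namespace (CONVENTIONS §2); for this
-- single-conjunct summit the two coincide, so the duplicate is deliberate.
set_option linter.dupNamespace false

noncomputable section

open Set Function MeasureTheory Filter
open scoped InnerProductSpace RealInnerProductSpace Topology

namespace Summit.AnomalousDissipation.AnomalousDissipation.Theorems.DenseLoudDesignerForces.Ergodic

open Literature.Analysis.FunctionSpaces Literature.Analysis.FunctionSpaces.Torus
open Literature.Analysis.FluidPDE Literature.Analysis.FluidPDE.Torus

/-! ## State curves of jointly smooth honest fields are differentiable in `H` -/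

/-- `‖[v] − [w] − c • [z]‖² = ∫‖v − w − c • z‖²` for honest (smooth, divergence-free, mean-zero) fields: the state
`[v] − [w] − c • [z]` is represented by `v − w − c • z` (`rep_stateOf`, `Lp.coeFn_sub`, `Lp.coeFn_smul`). [folklore] -/
theorem norm_stateOf_sub_sub_smul_sq {v w z : (UnitAddTorus (Fin 3)) → (EuclideanSpace ℝ (Fin 3))}
    (hv : IsSmooth v) (hvd : IsDivFree v) (hvm : HasZeroMean v) (hw : IsSmooth w) (hwd : IsDivFree w)
    (hwm : HasZeroMean w) (hz : IsSmooth z) (hzd : IsDivFree z) (hzm : HasZeroMean z) (c : ℝ) :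
    ‖stateOf v - stateOf w - c • stateOf z‖ ^ 2 = ∫ y, ‖v y - w y - c • z y‖ ^ 2 := by
  have h1 : rep (stateOf v - stateOf w - c • stateOf z) =ᵐ[volume]
      fun y => rep (stateOf v - stateOf w) y - rep (c • stateOf z) y := by
    show (((stateOf v - stateOf w - c • stateOf z : Hsp) :
        Lp (EuclideanSpace ℝ (Fin 3)) 2 (volume : Measure (UnitAddTorus (Fin 3)))) :
        (UnitAddTorus (Fin 3)) → (EuclideanSpace ℝ (Fin 3))) =ᵐ[volume] _
    rw [Submodule.coe_sub]
    exact Lp.coeFn_sub _ _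
  have h2 : rep (stateOf v - stateOf w) =ᵐ[volume] fun y => rep (stateOf v) y - rep (stateOf w) y := by
    show (((stateOf v - stateOf w : Hsp) : Lp (EuclideanSpace ℝ (Fin 3)) 2 (volume : Measure (UnitAddTorus (Fin 3)))) :
        (UnitAddTorus (Fin 3)) → (EuclideanSpace ℝ (Fin 3))) =ᵐ[volume] _
    rw [Submodule.coe_sub]
    exact Lp.coeFn_sub _ _
  have h3 : rep (c • stateOf z) =ᵐ[volume] fun y => c • rep (stateOf z) y := by
    show (((c • stateOf z : Hsp) : Lp (EuclideanSpace ℝ (Fin 3)) 2 (volume : Measure (UnitAddTorus (Fin 3)))) :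
        (UnitAddTorus (Fin 3)) → (EuclideanSpace ℝ (Fin 3))) =ᵐ[volume] _
    rw [Submodule.coe_smul]
    exact Lp.coeFn_smul _ _
  have hrep : rep (stateOf v - stateOf w - c • stateOf z) =ᵐ[volume] fun y => v y - w y - c • z y := by
    filter_upwards [h1, h2, h3, rep_stateOf hv hvd hvm, rep_stateOf hw hwd hwm, rep_stateOf hz hzd hzm]
      with y e1 e2 e3 e4 e5 e6
    rw [e1, e2, e3, e4, e5, e6]
  exact stub_trajectoryPowerBudget_aux_norm_sq _ hrep

/-- **The state curve of a jointly smooth honest field is differentiable in `H`.**  For `v` jointly smooth on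
`[a, b] × T³`, `a < b`, with divergence-free mean-zero slices, the state curve `s ↦ [v s]` has derivative
`[∂ₜv t]` within `[a, b]` at every `t ∈ [a, b]` (`∂ₜv = Torus.timeDerivWithin (Icc a b) v`, one-sided at the
endpoints): `∂ₜv t` is smooth, divergence free (`Torus.IsSmoothSpaceTimeOn.isDivFree_timeDerivWithin`) and mean zero
(`….hasZeroMean_timeDerivWithin`), so `[∂ₜv t]` is honest, and
`‖[v s] − [v t] − (s − t) • [∂ₜv t]‖² = ∫‖v s − v t − (s − t) • ∂ₜv t‖² ≤ (ε |s − t|)²` for `s` near `t` within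
`[a, b]` (`….eventually_integral_norm_sub_sub_smul_sq_le`, the uniform Taylor expansion in time) — classical solutions
are strong `H`-valued `C¹` curves (Constantin–Foias 1988, Ch. 5 (5.9)–(5.10)). [folklore] -/
theorem hasDerivWithinAt_stateOf {a b : ℝ} (hab : a < b) {v : ℝ → (UnitAddTorus (Fin 3)) → (EuclideanSpace ℝ (Fin 3))}
    (hv : IsSmoothSpaceTimeOn (Icc a b) v) (hd : ∀ s ∈ Icc a b, IsDivFree (v s))
    (hm : ∀ s ∈ Icc a b, HasZeroMean (v s)) {t : ℝ} (ht : t ∈ Icc a b) :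
    HasDerivWithinAt (fun s => stateOf (v s)) (stateOf (Torus.timeDerivWithin (Icc a b) v t)) (Icc a b) t := by
  have hU : UniqueDiffOn ℝ (Icc a b) := uniqueDiffOn_Icc hab
  have hvs : ∀ s ∈ Icc a b, IsSmooth (v s) := fun s hs => hv.isSmooth_slice hs
  have h1 : IsSmooth (Torus.timeDerivWithin (Icc a b) v t) := hv.isSmooth_timeDerivWithin hU ht
  have h2 : IsDivFree (Torus.timeDerivWithin (Icc a b) v t) := hv.isDivFree_timeDerivWithin hab hd ht
  have h3 : HasZeroMean (Torus.timeDerivWithin (Icc a b) v t) := hv.hasZeroMean_timeDerivWithin hab hm ht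
  rw [hasDerivWithinAt_iff_isLittleO, Asymptotics.isLittleO_iff]
  intro ε hε
  filter_upwards [hv.eventually_integral_norm_sub_sub_smul_sq_le (convex_Icc a b) ht hε, self_mem_nhdsWithin]
    with s hs hsS
  have hsq : ‖stateOf (v s) - stateOf (v t) - (s - t) • stateOf (Torus.timeDerivWithin (Icc a b) v t)‖ ^ 2 ≤
      (ε * |s - t|) ^ 2 := by
    rw [norm_stateOf_sub_sub_smul_sq (hvs s hsS) (hd s hsS) (hm s hsS) (hvs t ht) (hd t ht) (hm t ht) h1 h2 h3]
    exact hs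
  rw [Real.norm_eq_abs]
  exact (pow_le_pow_iff_left₀ (norm_nonneg _) (by positivity) two_ne_zero).1 hsq

/-! ## The frame curve of a classical trajectory -/

/-- **Tools stub A3a — THE FRAME CURVE OF A CLASSICAL TRAJECTORY IS DIFFERENTIABLE, WITH DERIVATIVE THE FRAME OF
`∂ₜu` (block N-A; the flow direction of the model).**  With the Stokes mode basis `b` (`(b i : L²) = stokesModeL2 k a c`,
`m i = 4π²|k|²`) and the frame `S = diag((1 + m)^{-1/2})`, let `(u, p)` be a classical solution of NS_ν(F) on
`[a₀, a₀ + τ'] × T³` with mean-zero slices, `y` its frame curve, `S (y t) = [u(a₀ + t)]` on `[0, τ']`, and `y₁` the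
frame curve of its time derivative, `S (y₁ t) = [∂ₜu(a₀ + t)]` (`∂ₜu = Torus.timeDerivWithin (Icc a₀ (a₀ + τ')) u`,
smooth, divergence free and mean zero, so the state is honest).  Then `y` has derivative `y₁ t` within `[0, τ']` at
every `t ∈ [0, τ']`.  Proof: by the frame preimage formula (`eq_frame_apply_of_frame_apply_eq_stateOf`)
`y s = S ([u(a₀ + s)] − [Δu(a₀ + s)])` on `[0, τ']` and `y₁ t = S ([∂ₜu(a₀ + t)] − [Δ∂ₜu(a₀ + t)])`; the state curves
of the jointly smooth honest fields `u` and `Δu` are differentiable within the window with derivatives `[∂ₜu]` and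
`[∂ₜΔu] = [Δ∂ₜu]` (`hasDerivWithinAt_stateOf`, `Torus.timeDerivWithin_laplacian_comm`), `S` is a bounded linear map,
and `s ↦ a₀ + s` maps `[0, τ']` into the window (Constantin–Foias 1988, Ch. 5 (5.9)–(5.10); Temam 1995, §3.4).
[folklore] -/
theorem stub_frameCurveDerivTools (ι : Type) (b : HilbertBasis ι ℝ Hsp) (m : ι → ℝ) (hpos : ∀ i, 0 < m i)
    (hb : ∀ i, ∃ (k : Fin 3 → ℤ) (a : EuclideanSpace ℝ (Fin 3)) (c : Bool), k ≠ 0 ∧ a ≠ 0 ∧ ⟪latticeVec k, a⟫_ℝ = 0 ∧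
      ((b i : Hsp) : Lp (EuclideanSpace ℝ (Fin 3)) 2 (volume : Measure (UnitAddTorus (Fin 3)))) = stokesModeL2 k a c ∧
      m i = stokesEigenvalue k)
    (S : Hsp →L[ℝ] Hsp) (hS : ∀ i, S (b i) = ((1 + m i) ^ (-(1 / 2 : ℝ))) • b i)
    {ν : ℝ} {F : (UnitAddTorus (Fin 3)) → (EuclideanSpace ℝ (Fin 3))} {a₀ τ' : ℝ} (hτ' : 0 < τ')
    {u : ℝ → (UnitAddTorus (Fin 3)) → (EuclideanSpace ℝ (Fin 3))} {p : ℝ → (UnitAddTorus (Fin 3)) → ℝ}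
    (hsol : IsClassicalNSSolutionOn (Icc a₀ (a₀ + τ')) ν (fun _ => F) u p) (hmean : ∀ t ∈ Icc a₀ (a₀ + τ'), HasZeroMean (u t))
    (y y₁ : ℝ → Hsp) (hy : ∀ t ∈ Icc (0 : ℝ) τ', S (y t) = stateOf (u (a₀ + t)))
    (hy₁ : ∀ t ∈ Icc (0 : ℝ) τ', S (y₁ t) = stateOf (Torus.timeDerivWithin (Icc a₀ (a₀ + τ')) u (a₀ + t))) :
    ∀ t ∈ Icc (0 : ℝ) τ', HasDerivWithinAt y (y₁ t) (Icc 0 τ') t := by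
  -- the positivity of the Stokes eigenvalues is part of the registered interface; it is not needed here
  have _ := hpos
  intro t ht
  have hab : a₀ < a₀ + τ' := by linarith
  have hU : UniqueDiffOn ℝ (Icc a₀ (a₀ + τ')) := uniqueDiffOn_Icc hab
  have hu : IsSmoothSpaceTimeOn (Icc a₀ (a₀ + τ')) u := hsol.smooth_velocity
  have hus : ∀ s ∈ Icc a₀ (a₀ + τ'), IsSmooth (u s) := fun s hs => hu.isSmooth_slice hs
  have hI : ∀ s ∈ Icc (0 : ℝ) τ', a₀ + s ∈ Icc a₀ (a₀ + τ') := fun s hs =>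
    ⟨by linarith [hs.1], by linarith [hs.2]⟩
  have hr : a₀ + t ∈ Icc a₀ (a₀ + τ') := hI t ht
  -- the Laplacian `Δu` is a jointly smooth field with divergence-free mean-zero slices
  have hΔ : IsSmoothSpaceTimeOn (Icc a₀ (a₀ + τ')) (fun s => laplacian (u s)) := hu.laplacian hU
  have hΔd : ∀ s ∈ Icc a₀ (a₀ + τ'), IsDivFree (laplacian (u s)) := fun s hs =>
    IsDivFree.laplacian_of_isSmooth (hus s hs) (hsol.divFree s hs)
  have hΔm : ∀ s ∈ Icc a₀ (a₀ + τ'), HasZeroMean (laplacian (u s)) := fun s hs =>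
    integral_laplacian_eq_zero_of_isSmooth (hus s hs)
  -- the time derivative `w = ∂ₜu(a₀ + t)` is honest, and `∂ₜΔu = Δ∂ₜu`
  obtain ⟨w, hw⟩ : ∃ w, w = Torus.timeDerivWithin (Icc a₀ (a₀ + τ')) u (a₀ + t) := ⟨_, rfl⟩
  have hw1 : IsSmooth w := hw ▸ hu.isSmooth_timeDerivWithin hU hr
  have hw2 : IsDivFree w := hw ▸ hsol.isDivFree_timeDerivWithin hab hr
  have hw3 : HasZeroMean w := hw ▸ hu.hasZeroMean_timeDerivWithin hab hmean hr
  have hΔw : Torus.timeDerivWithin (Icc a₀ (a₀ + τ')) (fun s => laplacian (u s)) (a₀ + t) = laplacian w := by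
    rw [hw]
    exact funext fun x => timeDerivWithin_laplacian_comm hab hu hr x
  -- Step 1: the state curves of `u` and `Δu` are differentiable within the window at `a₀ + t`
  have h1 : HasDerivWithinAt (fun s => stateOf (u s)) (stateOf w) (Icc a₀ (a₀ + τ')) (a₀ + t) :=
    hw ▸ hasDerivWithinAt_stateOf hab hu hsol.divFree hmean hr
  have h2 : HasDerivWithinAt (fun s => stateOf (laplacian (u s))) (stateOf (laplacian w)) (Icc a₀ (a₀ + τ'))
      (a₀ + t) :=
    hΔw ▸ hasDerivWithinAt_stateOf hab hΔ hΔd hΔm hr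
  -- Step 2: the explicit frame curve `s ↦ S ([u] − [Δu])(a₀ + s)` is differentiable within `[0, τ']` at `t`
  have h3 : HasDerivWithinAt (⇑S ∘ fun s => stateOf (u s) - stateOf (laplacian (u s)))
      (S (stateOf w - stateOf (laplacian w))) (Icc a₀ (a₀ + τ')) (a₀ + t) :=
    S.hasFDerivAt.comp_hasDerivWithinAt (a₀ + t) (h1.sub h2)
  have h4 : HasDerivWithinAt ((⇑S ∘ fun s => stateOf (u s) - stateOf (laplacian (u s))) ∘ fun s => a₀ + id s)
      ((1 : ℝ) • S (stateOf w - stateOf (laplacian w))) (Icc 0 τ') t :=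
    h3.scomp t ((hasDerivWithinAt_id t (Icc (0 : ℝ) τ')).const_add a₀) fun s hs => hI s hs
  rw [one_smul] at h4
  -- Step 3: `y` is this curve on `[0, τ']` and `y₁ t` is its derivative (frame preimages of honest states)
  have hyeq : ∀ s ∈ Icc (0 : ℝ) τ',
      y s = ((⇑S ∘ fun s => stateOf (u s) - stateOf (laplacian (u s))) ∘ fun s => a₀ + id s) s := fun s hs =>
    eq_frame_apply_of_frame_apply_eq_stateOf b hb hS (hus _ (hI s hs)) (hsol.divFree _ (hI s hs))
      (hmean _ (hI s hs)) (hy s hs)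
  have hy₁eq : y₁ t = S (stateOf w - stateOf (laplacian w)) :=
    eq_frame_apply_of_frame_apply_eq_stateOf b hb hS hw1 hw2 hw3 (hw ▸ hy₁ t ht)
  rw [hy₁eq]
  exact h4.congr hyeq (hyeq t ht)

end Summit.AnomalousDissipation.AnomalousDissipation.Theorems.DenseLoudDesignerForces.Ergodic

end
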